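import Mathlib
import HarnessLib
import HarnessLib.Audit
import Summits.AtomisticToContinuum.Statement
import Literature.MathematicalPhysics.StatisticalMechanics.LennardJonesClusters
import Summits.AtomisticToContinuum.Crystallization.Theorems.ExcessDecayLiouvilleCrysEnergyLimit
import Summits.AtomisticToContinuum.Crystallization.Theorems.PalmUnimodularRigidityChargedPatternCrystallizes
import Summits.AtomisticToContinuum.Crystallization.Theorems.BenjaminiSchrammPeriodicSupportBenjaminiSchrammLimit
import Summits.AtomisticToContinuum.Crystallization.Theorems.PricedLinkCensusChargedPeriodicIsOptimal

/-!
Route: SurfaceTensionNoFoam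

DORMANT since 2026-09-05T04:18:54Z (reconciler: no traction for 5 d (last activity item-proof-filed at 2026-08-31T03:27:27Z); parked, not closed — `ledger route dormant route-AtomisticToContinuum-SurfaceTensionNoFoam --off` to reactivat) — unstaffed, not closed; items shared with open routes are served there. `ledger route dormant <id> --off` reactivates.

# Route SurfaceTensionNoFoam — surface tension first — vacuum-adjacent sites of LJ ground states
cost c each (σ_LJ > 0 ⇒ NoFoam); Delone zero-pressure limits charge one crystal

It suffices to show X = ExposedSitesCost ∧ DeloneMinimisersChargePeriodic — a SURFACE half and a
BULK half that meet in exactly one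
place, relative density of the local limit. Conforming successor (D-0027 §2.1) of the retired route
SurfaceTensionFirst (same card,
closed 2026-08-15T13:47Z not-a-thesis: no deciding theorem); realises card
surface-tension-first-reflection-doubling (spine).
ExposedSitesCost (SURFACE TENSION FIRST, the card's Σ4/Σ5 in configuration form): there is a void
radius r₀ such that at every
observation radius R each particle of a Lennard-Jones ground state lying within R of an empty
r₀-ball (outer surface, internal voids,
cracks) costs at least c(R) > 0 above the periodic infimum e* = ⨅_Q e(Q): c·#exposed ≤ E(N) − N·e*.
With E(N)/N → e* (shared 0626)
the exposed fraction is o(1) — NoFoam, cohesion of ground states — and with the isoperimetric count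
#exposed ≥ c₁N^{2/3} it is the
headline σ_LJ := liminf (E(N) − Ne*)/N^{2/3} > 0 (SurfaceTensionPositive).
DeloneMinimisersChargePeriodic (BULK, rooted form): a
point-stationary law of rooted hard-core configurations of ℝ³ that is almost surely r₀-relatively
dense and has mean root energy
≤ e* charges an isometric copy of ONE periodic configuration at every scale with positive
probability. NoFoam is precisely what
upgrades the Benjamini–Schramm limit of the ground states (shared construction 9230) to the Delone
hypothesis of the bulk crux; the
shared hinge GroundStatesChargePeriodic (2911) and supports 2916/2913/0626 then give both conjuncts
of Crystallization.
Lean: `ExposedSitesCost ∧ DeloneMinimisersChargePeriodic`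

## Assembly
Deciding theorem `closes` (glue.lean; sorry-free in the planner's Sketch.lean, lean check rc 0,
axioms propext / Classical.choice /
Quot.sound), hypotheses = the 14 items, conclusion `_root_.Crystallization`: NoFoam :=
ExposedCostGivesNoFoam ExposedSitesCost
CrysEnergyLimit (the surface crux enters here); GroundStatesChargePeriodic := RootedLimitGlue
DeloneMinimisersChargePeriodic
BenjaminiSchrammLimit NoFoam CrysEnergyLimit (the bulk crux enters here); conjunct (ii)
IsCrystallizing lennardJones 3 :=
ChargedPatternCrystallizes _ LennardJonesMinimalDistance_holds (PROVED fact); conjunct (i): a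
ground-state sequence exists
(LennardJonesGroundStatesExist_holds, PROVED), its charged Q is least by ChargedPeriodicIsOptimal, ⨅
= e(Q) by IsLeast.csInf_eq, and
CrysEnergyLimit is then Tendsto (E(N)/N) (𝓝 e(Q)); the pair is HasPeriodicGroundStateEnergy ∧
IsCrystallizing =
Literature…Crystallization, of which `_root_.Crystallization` is the abbrev. VoidWallDeficit,
SurfaceTensionPositive and
ReflectionDoubling (and the derived NoFoam, GroundStatesChargePeriodic, Assembly) are hypotheses of
`closes` by the invariant but
unused in its proof: the first is the exposed-side half of ExposedSitesCost (child 1 of its foreseen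
split), the second its corollary,
the third its provable rung. The Assembly item below is the same chain as a Prop (provable now, pure
logic + the two proved facts).

Rationale: WHY THIS LINE. Every open route on this sub-problem attacks the bulk (local Hales rungs, stacking
selection, theta-universality, Palm rigidity,
unique continuation) and each silently needs cohesion of the finite ground states, while the surface
window E(N) = Ne* + O(N^{2/3})
is only ever used from above; this line makes the zero-temperature SURFACE TENSION the first theorem
— a lower bound sharp at e*
but equality-free and stacking-blind in statement, pricing only vacuum-adjacent sites (the 30
%-margin side of the margin map),
logically far below any defect-coercivity or Kepler-type bound (BlancLewin2015 §1.3, §2.2; Theil2006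
has the N^{1/2} term as an
upper error only). Imported: the add/remove/relocate-one-particle technology of cluster optimisation
(Xue1997, Blanc2004,
Yuhjtman2015, KiesslingWales2025 — there for the minimal distance, here for binding deficits of
void-wall sites), one-sided
kissing / contact-number combinatorics (Bezdek2011, BezdekKhan2018, Harborth1974), the Wulff-term
programme where σ > 0 is automatic
(HeitmannRadin1980, AuYeungFrieseckeSchmidt2012, Schmidt2013, FriedrichKreutz2023, arXiv:2204.12892)
and the surface-scaling
Γ-limits that ASSUME a non-negative coercive finite-range cell energy (KreutzZiereis2026
(E2),(E4),(E6)) — ExposedSitesCost is the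
vacuum-only, infinite-range version of that hypothesis for true Lennard-Jones; the bulk half uses
the objective method
(AldousSteele2004, AldousLyons2007) in ROOTED form, with no Palm inversion anywhere (contrast the
moot stationary crux 2910). Reflection doubling is the
quantitative form of the two-copies strict-subadditivity trick of BlancLewin2015 §1.2. Negatives
4146/3506 are steered around:
every statement quantifies over ground states (injective, 0.684-separated by
Yuhjtman2015_minDistance_holds) or separated rooted
laws, never over arbitrary configurations, and no first-shell classification at any tolerance is
asserted.

RANKED CRUXES. #2 ExposedSitesCost (crux) — (card Σ4/Σ5, configuration form, ground states only)
there is r₀ > 0 such that for every R > 0 some c > 0 satisfies, for every N and every N-particle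
Lennard-Jones ground state x in ℝ³: c·#{i : some point p with |p − x_i| ≤ R has no particle strictly
within distance r₀} ≤ E(N) − N·⨅_Q e(Q). Vacuum-adjacent particles (outer surface, internal voids
and cracks of radius ≥ r₀) each cost c above the periodic infimum; no minimiser is named, no
stability modulus and no stacking resolution appear (for R < r₀ the set is empty and the statement
is periodisation E(N) ≥ N e*; for N ≤ C R³ every particle is exposed and c(R) ≤ min a_N/N, positive
by strict subadditivity). Same statement as moot item 5287 of the retired route (filed anew: moot
items are not re-attached). [difficulty: open-problem] (why it might fail: True physically (σ_LJ >
0), but any proof must be exact at e* in the bulk with no equality analysis: Z ≥ 13 over-bound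
sheets (one-centre slack 1–3 %) could carry Θ(N^{2/3}) surplus against the ≈ 0.17·2|e*| deficit of
exposed sites; e* itself is uncertified.) [BlancLewin2015, Theil2006, KreutzZiereis2026,
FriedrichKreutz2023, AuYeungFrieseckeSchmidt2012, arXiv:1904.06169, BezdekKhan2018]
#3 DeloneMinimisersChargePeriodic (crux) — (bulk half, rooted = point-stationary form; new) for all
δ, r₀ > 0 and every probability law P on counting measures μ of ℝ³ that is (a) a.s. rooted and
hard-core (μ = count|S, 0 ∈ S, S δ-separated), (b) point-stationary (Mecke / mass-transport identity
E Σ_{y∈μ} g(μ, y) = E Σ_{y∈μ} g(θ_y μ, −y) for measurable g ≥ 0), (c) a.s. r₀-relatively dense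
(every ball of radius r₀ contains an atom) and (d) minimising, E_P[½ Σ_{y∈μ} V_LJ(‖y‖)] ≤ e* = ⨅_Q
e(Q): there is ONE periodic configuration Q such that for all R, ε > 0, with positive P-probability
the atoms of μ in the ball of radius R are two-way ε-matched with x ↦ A(s − q), s ∈ Q.points, for
some linear isometry A and base point q ∈ Q.points. Hypothesis (c) is exactly what NoFoam supplies
for Benjamini–Schramm limits of ground states; without it the statement would have to price walls
and half-crystals itself (that is PalmRigidity 9224 of route PalmUnimodularRigidity, which implies
this crux outright). [difficulty: open-problem] (why it might fail: Crystallization strength: an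
amorphous/polytetrahedral, quasicrystalline or continuum-of-environments minimising Delone law (no
fixed Q matched at all scales) kills it; potential-generic analogues are false (Radin1991, Sütő);
stacking selection rests on uncertified 1e-4 gaps.) [Radin1991, BlancLewin2015, Lewin2022,
AldousLyons2007, LastThorisson2009, FlatleyTheil2015, Stillinger2001]
#4 VoidWallDeficit (crux) — (card Rung 2 / Σ2, the exposed-side half of ExposedSitesCost in the
half-bond gauge) there is γ > 0 such that in every Lennard-Jones ground state every particle x_i on
the wall of an empty open unit ball (some p with |p − x_i| ≤ 1 and |p − x_j| ≥ 1 for all j; every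
convex-hull particle qualifies with p = x_i + outward unit normal) has site energy Σ_{k≠i} V_LJ(|x_i
− x_k|) ≥ 2·⨅_Q e(Q) + γ, i.e. binds by a uniform margin less than the bulk cohesive sum 2|e*| ≈
1.435. The empty ball removes a 60° cap (≥ 2–3 of 12 first neighbours, ≈ 15 % of the binding,
against ≤ 3 % one-centre over-binding slack); by one-particle relocation it bounds the adatom field
of every ground state by 2|e*| − γ + 1/12 everywhere (no deep re-entrant sites; vacancy exclusion
once L6/L12 numerics are certified — vacancies ARE locally stable, AyalaChoksiWirth2025 §4, so that
is a global statement). Child 1 of the foreseen split of ExposedSitesCost; same signature as moot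
5288. [difficulty: L] (why it might fail: A proof needs ground-state-specific local structure: with
only the proved separation 0.684 the cap-excluded one-centre maximum exceeds 1.435 (≈ 18 soft
neighbours allowed), the conjectured 0.891 (KiesslingWales2025) still allows 14; the certified
cap-excluded bound < 1.435 was never computed.) [Yuhjtman2015, KiesslingWales2025, Blanc2004,
Xue1997, Bezdek2011, BezdekKhan2018, AyalaChoksiWirth2025]
#9 SurfaceTensionPositive (support) — (card Σ4, the headline σ_LJ > 0 in effective form) there is c
> 0 with N·⨅_Q e(Q) + c·N^{2/3} ≤ E(N) for every N (N = 0, 1 harmless: E(0) = E(1) = 0, e* < 0). It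
follows from ExposedSitesCost by a column count (not filed as an item; provers attach the
implication with `--supports`): take R = r₀ and a ground state for each N ≥ 1
(LennardJonesGroundStatesExist_holds), 0.684-separated (Yuhjtman2015_minDistance_holds); with cubes
of side δ/2 the discrete Loomis–Whitney inequality gives a coordinate direction with ≥ N^{2/3}
occupied columns, the first contact of a ball of radius r₀ slid down each occupied column axis is an
exposed particle, and each particle is first contact for ≤ (2r₀/s + 1)² axes, so #exposed ≥
c₁N^{2/3}. Provable directly by any other means; the lower half of the surface window every
compactness argument uses from above. Same signature as moot 5290. [difficulty: open-problem]
[BlancLewin2015, arXiv:1904.06169, BezdekKhan2018, HeitmannRadin1980, Schmidt2013,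
LoomisWhitney1949]
#9 ReflectionDoubling (support) — (card Rung 1, provable now) for every injective N-configuration x
in ℝ³, unit vector u and ε ≥ 0: E(2N) ≤ 2·𝓔(x) + m_ε(u)·V_LJ(1 + 2ε), where m_ε(u) = #{i : ⟨x_j, u⟩
≤ ⟨x_i, u⟩ + ε for all j} is the population of the depth-ε cap in direction u. Proof: X' =
(reflection of x in its supporting plane ⟨·,u⟩ = h) + u, i.e. x_i' = x_i + (1 + 2t_i)u with t_i = h
− ⟨x_i,u⟩ ≥ 0; cross distances are √(|Δ⊥|² + (1 + t_i + t_j)²) ≥ 1, so x ∪ X' is injective, every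
cross term is ≤ 0 (lennardJones_nonpos) and particle i faces its own image at distance 1 + 2t_i
where V_LJ is increasing; E(2N) ≤ 𝓔(x ∪ X') (interactionEnergy_append,
groundStateEnergy_lennardJones_le, isometry invariance). With E(2N) ≥ 2N·e_∞
(BlancLewin2015_8_holds) and x a ground state: a_N ≥ ½|V_LJ(1 + 2ε)|·max_u m_ε(u) ≥ 0.034 × (largest
0.05-facet population). Same signature as moot 5292. [difficulty: provable-now] [BlancLewin2015]
#9 NoFoam (support) — (cohesion; same statement as moot item 2912, formerly a crux of
BenjaminiSchrammGroundStates and GscLoopSurgery, filed anew; DERIVED here by ExposedCostGivesNoFoam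
and provable directly by exchange/deformation arguments) there is r₀ > 0 such that for every R > 0
and every sequence of LJ ground states x^N, the fraction of particles i for which some point c with
|c − x_i| ≤ R has no particle within distance r₀ tends to 0. It is the one finite-N input that makes
every local (Benjamini–Schramm) limit of the ground states almost surely r₀-relatively dense.
[difficulty: L] [BlancLewin2015, LastPenrose2017]
#9 CrysEnergyLimit (support) — (shared item 0626, bookkeeping) E(N)/N converges to the infimum over
periodic configurations of the LJ energy per particle in d = 3: the limit e_∞ exists (BlancLewin2015
(8), proved in tree), e_∞ ≤ e(Q) by periodic trial blocks, e(Q_N) ≤ E(N)/N by periodising a ground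
state with a unit empty margin; the only place a_N = o(N) enters. [difficulty: M] [BlancLewin2015]
#9 ExposedCostGivesNoFoam (support) — (glue, card Σ3/C1) ExposedSitesCost → CrysEnergyLimit →
NoFoam: with r₀ from ExposedSitesCost and c = c(R), along any ground-state sequence 0 ≤ #exposed_N/N
≤ (E(N)/N − e*)/c → 0 (squeeze; the two exposure predicates are syntactically identical).
[difficulty: provable-now] [BlancLewin2015]
#9 BenjaminiSchrammLimit (support) — (shared CONSTRUCTION item 9230 of route PalmUnimodularRigidity,
verbatim) for every sequence of LJ ground states there are a subsequence φ, a hard core δ > 0 and a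
point-stationary probability law P on rooted δ-separated configurations with mean root energy lim_j
E(φ j)/φ j which is a LOCAL LIMIT in density-transfer form: for every set T of configurations, R, ε
> 0 and ρ < P(T), for all large j at least ρ·φ(j) particles of x^(φ j) have their recentred
configuration two-way (R, ε)-matched to some ν ∈ T. [difficulty: XL] [AldousLyons2007,
AldousSteele2004, LastPenrose2017, BlancLewin2015, HevelingLast2005]
#9 GroundStatesChargePeriodic (support) — (shared finite-N hinge, item 2911; here PRODUCED by
RootedLimitGlue) for every sequence of LJ ground states in ℝ³ there is ONE periodic configuration Q
such that for all R, ε > 0 there is ρ > 0 with, for infinitely many N, at least ρN particles whose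
R-neighbourhood is two-way ε-matched with x_i + A(Q.points − q) for some linear isometry A and base
point q ∈ Q.points. [difficulty: XL] [BlancLewin2015, AldousSteele2004]
#9 RootedLimitGlue (support) — (glue; the one place the two halves meet)
DeloneMinimisersChargePeriodic → BenjaminiSchrammLimit → NoFoam → CrysEnergyLimit →
GroundStatesChargePeriodic, with the statements of BenjaminiSchrammLimit (9230) and
GroundStatesChargePeriodic (2911) INLINED verbatim (the gate renders shared items after new ones;
definitional unfolding makes `hGlue hDel hBS hNF hLim : GroundStatesChargePeriodic` typecheck, see
`closes`). Proof: given ground states x take (φ, δ, P) from BenjaminiSchrammLimit. DENSITY: with r₀'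
from NoFoam put r₀ := r₀' + 1 and T_R := {μ : some c, ‖c‖ ≤ R, has no atom of μ within r₀}; a
particle two-way (R + r₀, 1/2)-matched to some ν ∈ T_R has an empty r₀'-ball centred within R of it,
so by the transfer clause and NoFoam every ρ < P(T_R) is ≤ 0, P(T_R) = 0 for all R ∈ ℕ, and P-a.s. μ
is r₀-relatively dense. ENERGY: E(φ j)/φ j tends both to E_P[h] and (CrysEnergyLimit ∘ φ) to e*, so
E_P[h] = e*. The bulk crux gives Q with P(G_{R',ε'}) > 0 for the matching events G; transfer with T
= G_{R+2, ε''/2}, ε'' = min ε 1, and composition of the two matchings (tolerances add, radius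
shrinks by ≤ 1) give ≥ (P(T)/2)·φ(j) particles (R, ε)-matched to x_i + A(Q.points − q) for all large
j, hence frequently in N. [difficulty: M] [AldousLyons2007, LastThorisson2009, BlancLewin2015]
#9 ChargedPeriodicIsOptimal (support) — (shared item 2913, SURGERY-ATTAINMENT) a periodic
configuration Q charged with positive density at every scale by some sequence of LJ ground states
has the least energy per particle among periodic configurations (excise charged R-patches, insert
Q'-patches with unit margin, compare with E(M)/M → e_∞ ≤ e(Q')): conjunct (i)'s attainment without
naming the minimiser. [difficulty: M] [BlancLewin2015, AldousSteele2004]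
#9 ChargedPatternCrystallizes (support) — (shared item 2916, soft) GroundStatesChargePeriodic →
LennardJonesMinimalDistance → IsCrystallizing lennardJones 3: scales (k, 1/k), good particles,
isometries aligned along a subsequence (compactness of O(3)); two-way matching plus the minimal
distance is eventually exact near every compact set, and
PeriodicConfiguration.tendsto_sum_of_eventually_near' (in tree) gives local convergence,
multiplicity 1. [difficulty: M] [BlancLewin2015]

TWO-LAYER PLAN. Foreseen split 1 (once VoidWallDeficit or a refuter's kit census moves):
ExposedSitesCost ⇐ VoidWallDeficitAtScale (every particle
within R of an empty r₀-ball lies within R + r₀ of a ball-TOUCHING particle, and touching particles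
have half-bond deficit ≥ γ/2:
VoidWallDeficit + packing) → SheetSurplusControl (the card's slab certificate: the over-binding
surplus Σ_i (e* − ½𝓔ⁱ)₊ of a ground
state is ≤ (γ/2 − c)·#touching; by the sub-ball bound Σ_{i∈W}(e* − ½𝓔ⁱ) ≤ ½|I(W, Wᶜ)| ≤ C R² it is
surface-like at every scale,
so only sheet-organised Z ≥ 13 environments between two half-crystal charges matter) →
ExposedSitesCost; glue = the half-bond
identity 2𝓔 = Σ_i 𝓔ⁱ (two_mul_interactionEnergy, in tree). Foreseen split 2:
DeloneMinimisersChargePeriodic ⇐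
DeloneMinimisersClosepackedShells (a.s. twelve soft neighbours in a Barlow chart) →
LayeredDeloneLawsSelectPeriod (stacking laws of
energy e* charge a periodic stacking) → crux, mirroring cruxes 9225–9227 of PalmUnimodularRigidity
so that children can be SHARED
with that route. Nothing filed now.

KILL CRITERIA. ExposedSitesCost refuted as typed (a ground-state family whose vacuum-adjacent count
exceeds (E(N) − Ne*)/c for every c: sponge-like
or over-bound-sheet minimisers) closes the route `refuted:ExposedSitesCost` — and puts NoFoam itself
in doubt for every cohesion-first
line. VoidWallDeficit refuted (a ground state with a void-wall or hull particle binding within every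
γ of 2|e*|) kills Rung 2 and
split 1 but not the route: restate ONCE with the void radius 1 replaced by a larger r₁ (half-space
limit); ReflectionDoubling and the
glue survive anything. DeloneMinimisersChargePeriodic refuted (an explicit minimising Delone
point-stationary law charging no periodic
Q — necessarily also ¬PalmRigidity 9224) closes this route's bulk half: re-attach the surface half
(ExposedSitesCost, NoFoam glue,
σ > 0) to whichever bulk route survives (HolmgrenBoyleLind's LIM needs exactly NoFoam), since
cohesion is route-independent. A "refutation" of a
surface item through the junk value of ⨅ (periodic energies unbounded below) is a typing slip
settled by proving CrysPeriodicBddBelow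
(0714), not a kill. Mooted-by: PalmRigidity (9224) ⇒ the bulk crux outright;
LjDefectCoercivity-type or Kepler-type bounds plus a surface clause ⇒ ExposedSitesCost; NoFoam
proved directly leaves `closes` intact
with the route's own content reduced to σ > 0 and the rungs.

NOT DECOMPOSED YET. The gauge / slab-certificate format of SheetSurplusControl and its constants
(B_half, the Z = 13/14 trap slack, L6/L12 of hcp — card
margin-map-one-centre-traps); a near-sharp minimal distance (≥ 0.9; proved 0.684) that
VoidWallDeficit wants; CrysPeriodicBddBelow
(0714, shared with PalmUnimodularRigidity: e* = ⨅ is the genuine infimum; surface-item provers may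
take it via `--supports`) and
periodisation E(N) ≥ N e* (moot 0715); the surface window from above a_N ≤ C·N^{2/3} (needed only
for bisection cohesion and diam =
O(N^{1/3}), NOT filed); the column-count implication ExposedSitesCost → SurfaceTensionPositive (a
`--supports` lemma); vacancy
exclusion (adatom field ≤ 2|e*| − γ + 1/12 versus the binding ≈ 1.3–1.43 of a relaxed vacancy site:
certified lattice numerics);
the card's steep-Mie (2p, p) test-bed; the internals of BenjaminiSchrammLimit (one shared XL
support) and of the bulk crux (split 2).
All are layer-2 children or `--supports` lemmas, later.

CHEAPEST FALSIFIER. For VoidWallDeficit / ExposedSitesCost together: over the putative LJ global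
minima N ≤ 1000 (Cambridge Cluster Database: Mackay
icosahedra, Marks decahedra, fcc truncated octahedra, Leary tetrahedron) tabulate (a) the maximal
binding β_i = −𝓔ⁱ of particles
touching an empty unit ball and (b) the ratio (𝓔(x) − N·e(hcp))/#exposed(r₀ = R = 1). Predicted: max
β ≤ 1.435 − γ with γ ≳ 0.15 and
a ratio floor ≳ 0.2 uniformly in N; one cluster with a void-wall particle at β ≥ 1.40, or a ratio
drifting to 0 with N, retires the
surface half (a refuter's kit job; compute-free hub, not run at open). Bulk crux: a point-stationary
Delone law of energy ≤ e(hcp)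
from aperiodically faulted relaxed stackings does NOT kill it (hcp runs of every length keep
positive frequency); a quasicrystalline
or amorphous competitor at e* would. ReflectionDoubling cannot fail (three lines of algebra,
verified above). Lookups done (card
audits ×3, gen-1, this session): no printed lower bound E(N) − Ne* ≥ cN^{2/3}, exposed-site cost or
vacancy exclusion for off-lattice
LJ in d ≥ 2; d = 1 only (arXiv:1904.06169 Prop 3.4); on-lattice/sticky analogues only.

NUMBERS. V_LJ = r⁻¹²/12 − r⁻⁶/6, V(1) = −1/12; e* ≈ −8.61/12 = −0.7175 (fcc/hcp lattice sums,
Stillinger2001; hcp below fcc by ≈ 1e-4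
relative), bulk cohesive sum 2|e*| ≈ 1.435 = 12 unit bonds + 0.435 tail; hull/facet binding ≈
1.0–1.1 (≤ 9 touching + half tail);
Z = 13/14 one-centre over-binding slack 1–3 % (card margin-map-one-centre-traps, uncertified);
½|V_LJ(1.1)| = 0.034; minimal distance in LJ ground states: PROVED 0.684
(Yuhjtman2015_minDistance_holds, tree)
and 1/3 (LennardJonesMinimalDistance_holds), observed minimum 0.903 at N = 923, conjectured > 0.891
(KiesslingWales2025); largest
hole of fcc/hcp at a* ≈ 0.971: 0.69 (octahedral), single-vacancy hole 0.97 — both < 1 = the void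
radius (r₀ = 1 voids are
multi-vacancy cavities); empty tangent unit ball ⇒ empty 60° cap for neighbours at distance ≤ 1;
sticky analogue: contacts ≤ 6N −
0.926N^{2/3} (BezdekKhan2018 Thm (i)); putative LJ cluster
energies E(N) ≈ N·e* + b·N^{2/3} with b ≈ 1.2 in tree units (icosahedral/decahedral fits, Doye2000),
so the expected c(r₀ = R = 1)
is ≈ 0.25 and σ_LJ ≈ 1.2. Items at open: 14 (3 cruxes, 10 supports of which 5 attach to open shared
items — 0626, 2911, 2913, 2916, 9230 — while NoFoam restates moot
2912 verbatim; and 1 assembly).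

DEFINITION REQUESTS. None needed to elaborate: exposure, void walls, cap populations, rootedness,
point-stationarity and pattern matching are inlined
over dist / inner / Nat.card / Measure.count.restrict / Measure.map exactly as in the shared items
2911, 9230; siteEnergy,
IsGroundState, groundStateEnergy, PeriodicConfiguration.energyPerParticle/points,
LennardJonesMinimalDistance exist
(Crystallization.lean, LennardJonesClusters.lean). Bib: KreutzZiereis2026 added this session (lit
cite arXiv:2604.19239). Cite fact
wanted later (not filed): none — Yuhjtman2015_minDistance (0.684) is already vendored AND proved.

Novelty: Searches (2026-08-15, this session): `lit search --source zbmath "Lennard-Jones crystallization"`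
(12: Theil2006, E–Li 2009,
DeLuca–Friesecke 2018, Bétermin ×4, Crismale–Kubin–Ninno–Ponsiglione 2023
failure-of-crystallization, arXiv:2506.22614); `… zbmath
"surface energy crystallization atomistic"` (4: AuYeungFrieseckeSchmidt2012, arXiv:2204.12892
Cicalese–Kreutz–Leonardi on-lattice
fcc/hcp Wulff, Piovano–Velčić ×2 on-lattice wetting/Winterbottom); `… zbmath "surface energy pair
potential discrete"` (12: Theil 2011
doi:10.1051/m2an/2010106 2-D mass–spring surface energies, arXiv:2006.01558 sticky-disc
polycrystals); `… zbmath "sticky disc Wulff"`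
(2: Schmidt2013 N^{3/4} law); `… zbmath "contact number sphere packing upper bound"` (5: Bezdek 2021
arXiv:2010.05091); `lit search
--source crossref "surface energy Lennard-Jones clusters asymptotics ground state"` (14:
Doye–Miller–Wales 1999, Northby–Xie 1989
binding of large icosahedral/cuboctahedral clusters, Šiber 2004 — numerics only); `lit frontier
AtomisticToContinuum --since 2021` (30
rows; crystallization side only arXiv:2407.20762 and arXiv:2604.19239 = KreutzZiereis2026, READ pp.
2–6: general-d polycrystal
Γ-limit in the surface-scaling regime ASSUMING a non-negative, coercive, finite-range cell energy
(E2), (E4), (E6)); `lit bridges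
AtomisticToContinuum --cross any` (30, none relevant); `lit galaxy search "surface energy of
Lennard-Jones clusters" --star all` (0)
and `--star pdf "surface energy"` (15, materials-science n  [refs: 10.1051/m2an/2010106, 2506.22614, 2204.12892, 2006.01558, 2010.05091, 2407.20762, 2604.19239, 1904.06169, doi:10.1051/m2an/2010106, Theil2006, AuYeungFrieseckeSchmidt2012, Schmidt2013, KreutzZiereis2026, FlatleyTheil2015, BezdekKhan2018, FriedrichKreutz2023, Blanc2004, Xue1997, Yuhjtman2015, AldousLyons2007]

Barriers (technique_class: surface-tension one-particle-moves slab-certificate): - technique_class: surface-tension one-particle-moves slab-certificate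
- Literature.Barriers.AtomisticToContinuum.IcosahedralClusters: applies to any finite-N structural
claim; none is made — Mackay icosahedra are faceted (ReflectionDoubling gives a_N ≍ N^{2/3} for
them), compact and surface-priced, consistent with every item; LJ₁₃ pays (E(13) − 13e*)/13 ≈ 0.43
per (exposed) particle.
- Literature.Barriers.AtomisticToContinuum.StickySphereClusters: same; small-N degeneracy is
invisible to ∃c-statements and to a liminf; in the sticky limit ExposedSitesCost is Bezdek–Reid's
theorem.
- Literature.Barriers.AtomisticToContinuum.DecahedralSoftShell: not met — no item classifies first
shells at any tolerance (the witness that refuted negatives-index item 4146 needs a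
kissing/Hales-type crux to bite); a D5h shell particle is interior, not void-wall.
- Literature.Barriers.AtomisticToContinuum.TetrahedralFrustration: APPLIES to any proof of
ExposedSitesCost in the form of Z ≥ 13 over-binding; not evaded but relocated — by the sub-ball
bound surplus is surface-like at every scale, so only sheet-organised frustration between two bulk
charges matters; the bet is that such sheets cannot carry positive surplus density against the ≥
0.15·2|e*| deficit of exposed sites. VoidWallDeficit evades it by margin (empty 60° cap ≈ 15 % ≫ 3 %
trap slack). It also bites the bulk crux (polytetrahedral Delone minimisers), where the bet is
shared with every bulk route.
- Literature.Barriers.AtomisticToCont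

History (route lifecycle, newest last):
- 2026-08-23T13:36:02Z · DORMANT — reconciler: no traction for 6.1 d (last activity statement-attached at 2026-08-17T10:54:20Z); parked, not closed — `ledger route dormant route-AtomisticToContin (operator:999:2169854)
- 2026-08-30T06:27:30Z · REACTIVATED — reconciler: reactivated — activity statement-attached at 2026-08-30T05:16:25Z after parking at 2026-08-23T13:36:02Z (operator:999:2876057)
- 2026-09-05T04:18:54Z · DORMANT — reconciler: no traction for 5 d (last activity item-proof-filed at 2026-08-31T03:27:27Z); parked, not closed — `ledger route dormant route-AtomisticToContinuum- (operator:999:3289948)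

sub-problem: Crystallization · status: dormant · opened planner-plancard-AtomisticToContinuum-Crystal-2c2c210b-g2-0 2026-08-15T19:01:46Z · rev 1 · ledger route-AtomisticToContinuum-SurfaceTensionNoFoam
GENERATED by the gate from the ledger (D-0016/17). Provers cite these decls: `theorem foo : Summit.AtomisticToContinuum.Crystallization.Theses.SurfaceTensionNoFoam.<Decl> := …` in Summits/AtomisticToContinuum/Crystallization/Theorems/<Name>.lean.
-/

namespace Summit.AtomisticToContinuum.Crystallization.Theses.SurfaceTensionNoFoam

open scoped BigOperators Topology Manifold Classical MeasureTheory ProbabilityTheory Matrix InnerProductSpace ComplexConjugate ContinuousMap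
open Filter Set Function TopologicalSpace MeasureTheory

attribute [summit_statement] _root_.Crystallization

/-- item stmt-AtomisticToContinuum-13448 · crux · rank 2 · open · by planner
why it might fail: True physically (σ_LJ > 0), but any proof must be exact at e* in the bulk with no equality analysis: Z ≥ 13 over-bound sheets (one-centre slack 1–3 %) could carry Θ(N^{2/3}) surplus against the ≈ 0.17·2|e*| deficit of exposed sites; e* itself is uncertified.
sources: BlancLewin2015, Theil2006, KreutzZiereis2026, FriedrichKreutz2023, AuYeungFrieseckeSchmidt2012, arXiv:1904.06169
[crux] (card Σ4/Σ5, configuration form, ground states only) there is r₀ > 0 such that for every R >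
0 some c > 0 satisfies, for every N and every N-particle Lennard-Jones ground state x in ℝ³: c·#{i :
some point p with |p − x_i| ≤ R has no particle strictly within distance r₀} ≤ E(N) − N·⨅_Q e(Q).
Vacuum-adjacent particles (outer surface, internal voids and cracks of radius ≥ r₀) each cost c
above the periodic infimum; no minimiser is named, no stability modulus and no stacking resolution
appear (for R < r₀ the set is empty and the statement is periodisation E(N) ≥ N e*; for N ≤ C R³
every particle is exposed and c(R) ≤ min a_N/N, positive by strict subadditivity). Same statement as
moot item 5287 of the retired route (filed anew: moot items are not re-attached). [difficulty:
open-problem] -/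
@[route_item "route-AtomisticToContinuum-SurfaceTensionNoFoam"]
def ExposedSitesCost : Prop :=
  ∃ r₀ : ℝ, 0 < r₀ ∧ ∀ R : ℝ, 0 < R → ∃ c : ℝ, 0 < c ∧ ∀ (N : ℕ) (x : Fin N → EuclideanSpace ℝ (Fin 3)), Literature.MathematicalPhysics.StatisticalMechanics.IsGroundState Literature.MathematicalPhysics.StatisticalMechanics.lennardJones x → c * (Nat.card {i : Fin N // ∃ p : EuclideanSpace ℝ (Fin 3), dist p (x i) ≤ R ∧ ∀ j : Fin N, r₀ ≤ dist p (x j)} : ℝ) ≤ Literature.MathematicalPhysics.StatisticalMechanics.groundStateEnergy Literature.MathematicalPhysics.StatisticalMechanics.lennardJones 3 N - (N : ℝ) * (⨅ Q : Literature.MathematicalPhysics.StatisticalMechanics.PeriodicConfiguration 3, Q.energyPerParticle Literature.MathematicalPhysics.StatisticalMechanics.lennardJones)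

/-- item stmt-AtomisticToContinuum-13449 · crux · rank 3 · open · by planner
why it might fail: Crystallization strength: an amorphous/polytetrahedral, quasicrystalline or continuum-of-environments minimising Delone law (no fixed Q matched at all scales) kills it; potential-generic analogues are false (Radin1991, Sütő); stacking selection rests on uncertified 1e-4 gaps.
sources: Radin1991, BlancLewin2015, Lewin2022, AldousLyons2007, LastThorisson2009, FlatleyTheil2015
[crux] (bulk half, rooted = point-stationary form; new) for all δ, r₀ > 0 and every probability law
P on counting measures μ of ℝ³ that is (a) a.s. rooted and hard-core (μ = count|S, 0 ∈ S, S
δ-separated), (b) point-stationary (Mecke / mass-transport identity E Σ_{y∈μ} g(μ, y) = E Σ_{y∈μ}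
g(θ_y μ, −y) for measurable g ≥ 0), (c) a.s. r₀-relatively dense (every ball of radius r₀ contains
an atom) and (d) minimising, E_P[½ Σ_{y∈μ} V_LJ(‖y‖)] ≤ e* = ⨅_Q e(Q): there is ONE periodic
configuration Q such that for all R, ε > 0, with positive P-probability the atoms of μ in the ball
of radius R are two-way ε-matched with x ↦ A(s − q), s ∈ Q.points, for some linear isometry A and
base point q ∈ Q.points. Hypothesis (c) is exactly what NoFoam supplies for Benjamini–Schramm limits
of ground states; without it the statement would have to price walls and half-crystals itself (that
is PalmRigidity 9224 of route PalmUnimodularRigidity, which implies this crux outright).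
[difficulty: open-problem] -/
@[route_item "route-AtomisticToContinuum-SurfaceTensionNoFoam"]
def DeloneMinimisersChargePeriodic : Prop :=
  ∀ δ r₀ : ℝ, 0 < δ → 0 < r₀ → ∀ P : MeasureTheory.Measure (MeasureTheory.Measure (EuclideanSpace ℝ (Fin 3))), MeasureTheory.IsProbabilityMeasure P → (∀ᵐ μ ∂P, (∃ S : Set (EuclideanSpace ℝ (Fin 3)), (0 : EuclideanSpace ℝ (Fin 3)) ∈ S ∧ (∀ x ∈ S, ∀ y ∈ S, x ≠ y → δ ≤ dist x y) ∧ μ = (MeasureTheory.Measure.count : MeasureTheory.Measure (EuclideanSpace ℝ (Fin 3))).restrict S)) → (∀ g : MeasureTheory.Measure (EuclideanSpace ℝ (Fin 3)) → EuclideanSpace ℝ (Fin 3) → ENNReal, Measurable (Function.uncurry g) → ∫⁻ μ, ∫⁻ y, g μ y ∂μ ∂P = ∫⁻ μ, ∫⁻ y, g (MeasureTheory.Measure.map (fun z => z - y) μ) (-y) ∂μ ∂P) → (∀ᵐ μ ∂P, ∀ c : EuclideanSpace ℝ (Fin 3), ∃ y : EuclideanSpace ℝ (Fin 3), μ {y}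 ≠ 0 ∧ dist y c ≤ r₀) → (∫ μ, (∫ y, Literature.MathematicalPhysics.StatisticalMechanics.lennardJones ‖y‖ ∂μ) / 2 ∂P) ≤ (⨅ Q : Literature.MathematicalPhysics.StatisticalMechanics.PeriodicConfiguration 3, Q.energyPerParticle Literature.MathematicalPhysics.StatisticalMechanics.lennardJones) → ∃ Q : Literature.MathematicalPhysics.StatisticalMechanics.PeriodicConfiguration 3, ∀ R ε : ℝ, 0 < R → 0 < ε → 0 < P {μ | ∃ A : EuclideanSpace ℝ (Fin 3) →ₗᵢ[ℝ] EuclideanSpace ℝ (Fin 3), ∃ q ∈ Q.points, (∀ s ∈ Q.points, dist s q ≤ R → ∃ y : EuclideanSpace ℝ (Fin 3), μ {y} ≠ 0 ∧ dist y (A (s - q)) ≤ ε) ∧ (∀ y : EuclideanSpace ℝ (Fin 3), μ {y} ≠ 0 → ‖y‖ ≤ R → ∃ s ∈ Q.points, dist y (A (s - q)) ≤ ε)}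

/-- item stmt-AtomisticToContinuum-13450 · crux · rank 4 · open · by planner
why it might fail: A proof needs ground-state-specific local structure: with only the proved separation 0.684 the cap-excluded one-centre maximum exceeds 1.435 (≈ 18 soft neighbours allowed), the conjectured 0.891 (KiesslingWales2025) still allows 14; the certified cap-excluded bound < 1.435 was never computed.
sources: Yuhjtman2015, KiesslingWales2025, Blanc2004, Xue1997, Bezdek2011, BezdekKhan2018
[crux] (card Rung 2 / Σ2, the exposed-side half of ExposedSitesCost in the half-bond gauge) there is
γ > 0 such that in every Lennard-Jones ground state every particle x_i on the wall of an empty open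
unit ball (some p with |p − x_i| ≤ 1 and |p − x_j| ≥ 1 for all j; every convex-hull particle
qualifies with p = x_i + outward unit normal) has site energy Σ_{k≠i} V_LJ(|x_i − x_k|) ≥ 2·⨅_Q e(Q)
+ γ, i.e. binds by a uniform margin less than the bulk cohesive sum 2|e*| ≈ 1.435. The empty ball
removes a 60° cap (≥ 2–3 of 12 first neighbours, ≈ 15 % of the binding, against ≤ 3 % one-centre
over-binding slack); by one-particle relocation it bounds the adatom field of every ground state by
2|e*| − γ + 1/12 everywhere (no deep re-entrant sites; vacancy exclusion once L6/L12 numerics are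
certified — vacancies ARE locally stable, AyalaChoksiWirth2025 §4, so that is a global statement).
Child 1 of the foreseen split of ExposedSitesCost; same signature as moot 5288. [difficulty: L] -/
@[route_item "route-AtomisticToContinuum-SurfaceTensionNoFoam"]
def VoidWallDeficit : Prop :=
  ∃ γ : ℝ, 0 < γ ∧ ∀ (N : ℕ) (x : Fin N → EuclideanSpace ℝ (Fin 3)), Literature.MathematicalPhysics.StatisticalMechanics.IsGroundState Literature.MathematicalPhysics.StatisticalMechanics.lennardJones x → ∀ i : Fin N, (∃ p : EuclideanSpace ℝ (Fin 3), dist p (x i) ≤ 1 ∧ ∀ j : Fin N, 1 ≤ dist p (x j)) → 2 * (⨅ Q : Literature.MathematicalPhysics.StatisticalMechanics.PeriodicConfiguration 3, Q.energyPerParticle Literature.MathematicalPhysics.StatisticalMechanics.lennardJones) + γ ≤ Literature.MathematicalPhysics.StatisticalMechanics.siteEnergy Literature.MathematicalPhysics.StatisticalMechanics.lennardJones x i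

/-- item stmt-AtomisticToContinuum-0626 · support · rank 9 · closed · proved by Summit.AtomisticToContinuum.Crystallization.Theorems.crysEnergyLimit_proof @ f456c3bab3f9 (prover) · by planner
sources: BlancLewin2015
Energetic crystallization: E(N)/N converges to the infimum over periodic (multi-lattice)
configurations of the LJ energy per particle in d = 3. Lower bound liminf ≥ ⨅ is the content ((a)
local optimality + (d) + surface term O(N^{2/3})); upper bound is filed separately. -/
@[route_item "route-AtomisticToContinuum-SurfaceTensionNoFoam"]
def CrysEnergyLimit : Prop :=
  Filter.Tendsto (fun N : ℕ => Literature.MathematicalPhysics.StatisticalMechanics.groundStateEnergy Literature.MathematicalPhysics.StatisticalMechanics.lennardJones 3 N / N) Filter.atTop (nhds (⨅ Q : Literature.MathematicalPhysics.StatisticalMechanics.PeriodicConfiguration 3, Q.energyPerParticle Literature.MathematicalPhysics.StatisticalMechanics.lennardJones))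

/-- `CrysEnergyLimit` holds: proved by `Summit.AtomisticToContinuum.Crystallization.Theorems.crysEnergyLimit_proof` @ f456c3bab3f9. -/
theorem CrysEnergyLimit_holds : CrysEnergyLimit := _root_.Summit.AtomisticToContinuum.Crystallization.Theorems.crysEnergyLimit_proof

/-- item stmt-AtomisticToContinuum-13451 · support · rank 9 · open · by planner
sources: BlancLewin2015, arXiv:1904.06169, BezdekKhan2018, HeitmannRadin1980, Schmidt2013, LoomisWhitney1949
[support] (card Σ4, the headline σ_LJ > 0 in effective form) there is c > 0 with N·⨅_Q e(Q) +
c·N^{2/3} ≤ E(N) for every N (N = 0, 1 harmless: E(0) = E(1) = 0, e* < 0). It follows from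
ExposedSitesCost by a column count (not filed as an item; provers attach the implication with
`--supports`): take R = r₀ and a ground state for each N ≥ 1 (LennardJonesGroundStatesExist_holds),
0.684-separated (Yuhjtman2015_minDistance_holds); with cubes of side δ/2 the discrete Loomis–Whitney
inequality gives a coordinate direction with ≥ N^{2/3} occupied columns, the first contact of a ball
of radius r₀ slid down each occupied column axis is an exposed particle, and each particle is first
contact for ≤ (2r₀/s + 1)² axes, so #exposed ≥ c₁N^{2/3}. Provable directly by any other means; the
lower half of the surface window every compactness argument uses from above. Same signature as moot
5290. [difficulty: open-problem] -/
@[route_item "route-AtomisticToContinuum-SurfaceTensionNoFoam"]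
def SurfaceTensionPositive : Prop :=
  ∃ c : ℝ, 0 < c ∧ ∀ N : ℕ, (N : ℝ) * (⨅ Q : Literature.MathematicalPhysics.StatisticalMechanics.PeriodicConfiguration 3, Q.energyPerParticle Literature.MathematicalPhysics.StatisticalMechanics.lennardJones) + c * (N : ℝ) ^ (2 / 3 : ℝ) ≤ Literature.MathematicalPhysics.StatisticalMechanics.groundStateEnergy Literature.MathematicalPhysics.StatisticalMechanics.lennardJones 3 N

/-- item stmt-AtomisticToContinuum-13452 · support · rank 9 · open · by planner
sources: BlancLewin2015
[support] (card Rung 1, provable now) for every injective N-configuration x in ℝ³, unit vector u and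
ε ≥ 0: E(2N) ≤ 2·𝓔(x) + m_ε(u)·V_LJ(1 + 2ε), where m_ε(u) = #{i : ⟨x_j, u⟩ ≤ ⟨x_i, u⟩ + ε for all j}
is the population of the depth-ε cap in direction u. Proof: X' = (reflection of x in its supporting
plane ⟨·,u⟩ = h) + u, i.e. x_i' = x_i + (1 + 2t_i)u with t_i = h − ⟨x_i,u⟩ ≥ 0; cross distances are
√(|Δ⊥|² + (1 + t_i + t_j)²) ≥ 1, so x ∪ X' is injective, every cross term is ≤ 0
(lennardJones_nonpos) and particle i faces its own image at distance 1 + 2t_i where V_LJ is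
increasing; E(2N) ≤ 𝓔(x ∪ X') (interactionEnergy_append, groundStateEnergy_lennardJones_le, isometry
invariance). With E(2N) ≥ 2N·e_∞ (BlancLewin2015_8_holds) and x a ground state: a_N ≥ ½|V_LJ(1 +
2ε)|·max_u m_ε(u) ≥ 0.034 × (largest 0.05-facet population). Same signature as moot 5292.
[difficulty: provable-now] -/
@[route_item "route-AtomisticToContinuum-SurfaceTensionNoFoam"]
def ReflectionDoubling : Prop :=
  ∀ (N : ℕ) (x : Fin N → EuclideanSpace ℝ (Fin 3)), Function.Injective x → ∀ (u : EuclideanSpace ℝ (Fin 3)), ‖u‖ = 1 → ∀ ε : ℝ, 0 ≤ ε → Literature.MathematicalPhysics.StatisticalMechanics.groundStateEnergy Literature.MathematicalPhysics.StatisticalMechanics.lennardJones 3 (2 * N) ≤ 2 * Literature.MathematicalPhysics.StatisticalMechanics.interactionEnergy Literature.MathematicalPhysics.StatisticalMechanics.lennardJones x + (Nat.card {i : Fin N // ∀ j : Fin N, inner ℝ (x j) u ≤ inner ℝ (x i) u + ε} : ℝ) * Literature.MathematicalPhysics.StatisticalMechanics.lennardJones (1 + 2 * ε)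

/-- item stmt-AtomisticToContinuum-13453 · support · rank 9 · open · by planner
sources: BlancLewin2015, LastPenrose2017
[support] (cohesion; same statement as moot item 2912, formerly a crux of
BenjaminiSchrammGroundStates and GscLoopSurgery, filed anew; DERIVED here by ExposedCostGivesNoFoam
and provable directly by exchange/deformation arguments) there is r₀ > 0 such that for every R > 0
and every sequence of LJ ground states x^N, the fraction of particles i for which some point c with
|c − x_i| ≤ R has no particle within distance r₀ tends to 0. It is the one finite-N input that makes
every local (Benjamini–Schramm) limit of the ground states almost surely r₀-relatively dense.
[difficulty: L] -/
@[route_item "route-AtomisticToContinuum-SurfaceTensionNoFoam"]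
def NoFoam : Prop :=
  ∃ r₀ : ℝ, 0 < r₀ ∧ ∀ R : ℝ, 0 < R → ∀ x : (N : ℕ) → (Fin N → EuclideanSpace ℝ (Fin 3)), (∀ N, Literature.MathematicalPhysics.StatisticalMechanics.IsGroundState Literature.MathematicalPhysics.StatisticalMechanics.lennardJones (x N)) → Filter.Tendsto (fun N : ℕ => (Nat.card {i : Fin N // ∃ c : EuclideanSpace ℝ (Fin 3), dist c (x N i) ≤ R ∧ ∀ j : Fin N, r₀ ≤ dist c (x N j)} : ℝ) / N) Filter.atTop (nhds 0)

/-- item stmt-AtomisticToContinuum-13454 · support · rank 9 · closed · proved by Summit.AtomisticToContinuum.Crystallization.Theorems.exposedCostGivesNoFoam_proof (prover) · by planner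
sources: BlancLewin2015
[support] (glue, card Σ3/C1) ExposedSitesCost → CrysEnergyLimit → NoFoam: with r₀ from
ExposedSitesCost and c = c(R), along any ground-state sequence 0 ≤ #exposed_N/N ≤ (E(N)/N − e*)/c →
0 (squeeze; the two exposure predicates are syntactically identical). [difficulty: provable-now] -/
@[route_item "route-AtomisticToContinuum-SurfaceTensionNoFoam"]
def ExposedCostGivesNoFoam : Prop :=
  ExposedSitesCost → CrysEnergyLimit → NoFoam

-- `ExposedCostGivesNoFoam` holds: proved by `Summit.AtomisticToContinuum.Crystallization.Theorems.exposedCostGivesNoFoam_proof` (its module imports this route file, so no `_holds` link can be stated here).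

/-- item stmt-AtomisticToContinuum-13455 · support · rank 9 · open · by planner
sources: AldousLyons2007, LastThorisson2009, BlancLewin2015
[support] (glue; the one place the two halves meet) DeloneMinimisersChargePeriodic →
BenjaminiSchrammLimit → NoFoam → CrysEnergyLimit → GroundStatesChargePeriodic, with the statements
of BenjaminiSchrammLimit (9230) and GroundStatesChargePeriodic (2911) INLINED verbatim (the gate
renders shared items after new ones; definitional unfolding makes `hGlue hDel hBS hNF hLim :
GroundStatesChargePeriodic` typecheck, see `closes`). Proof: given ground states x take (φ, δ, P)
from BenjaminiSchrammLimit. DENSITY: with r₀' from NoFoam put r₀ := r₀' + 1 and T_R := {μ : some c,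
‖c‖ ≤ R, has no atom of μ within r₀}; a particle two-way (R + r₀, 1/2)-matched to some ν ∈ T_R has
an empty r₀'-ball centred within R of it, so by the transfer clause and NoFoam every ρ < P(T_R) is ≤
0, P(T_R) = 0 for all R ∈ ℕ, and P-a.s. μ is r₀-relatively dense. ENERGY: E(φ j)/φ j tends both to
E_P[h] and (CrysEnergyLimit ∘ φ) to e*, so E_P[h] = e*. The bulk crux gives Q with P(G_{R',ε'}) > 0
for the matching events G; transfer with T = G_{R+2, ε''/2}, ε'' = min ε 1, and composition of the
two matchings (tolerances add, radius shrinks by ≤ 1) give ≥ (P(T)/2)·φ(j) particles (R, ε)-matched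
to x_i + A(Q.points − q) for a -/
@[route_item "route-AtomisticToContinuum-SurfaceTensionNoFoam"]
def RootedLimitGlue : Prop :=
  DeloneMinimisersChargePeriodic → (∀ x : (N : ℕ) → (Fin N → EuclideanSpace ℝ (Fin 3)), (∀ N, Literature.MathematicalPhysics.StatisticalMechanics.IsGroundState Literature.MathematicalPhysics.StatisticalMechanics.lennardJones (x N)) → ∃ φ : ℕ → ℕ, StrictMono φ ∧ ∃ δ : ℝ, 0 < δ ∧ ∃ P : MeasureTheory.Measure (MeasureTheory.Measure (EuclideanSpace ℝ (Fin 3))), MeasureTheory.IsProbabilityMeasure P ∧ (∀ᵐ μ ∂P, (∃ S : Set (EuclideanSpace ℝ (Fin 3)), (0 : EuclideanSpace ℝ (Fin 3)) ∈ S ∧ (∀ x ∈ S, ∀ y ∈ S, x ≠ y → δ ≤ dist x y) ∧ μ = (MeasureTheory.Measure.count : MeasureTheory.Measure (EuclideanSpace ℝ (Fin 3))).restrict S)) ∧ (∀ g : MeasureTheory.Measure (EuclideanSpace ℝ (Fin 3)) → EuclideanSpace ℝ (Fin 3) → ENNReal, Measurable (Function.uncurry g) → ∫⁻ μ, ∫⁻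 y, g μ y ∂μ ∂P = ∫⁻ μ, ∫⁻ y, g (MeasureTheory.Measure.map (fun z => z - y) μ) (-y) ∂μ ∂P) ∧ Filter.Tendsto (fun j : ℕ => Literature.MathematicalPhysics.StatisticalMechanics.groundStateEnergy Literature.MathematicalPhysics.StatisticalMechanics.lennardJones 3 (φ j) / (φ j : ℝ)) Filter.atTop (nhds (∫ μ, (∫ y, Literature.MathematicalPhysics.StatisticalMechanics.lennardJones ‖y‖ ∂μ) / 2 ∂P)) ∧ ∀ T : Set (MeasureTheory.Measure (EuclideanSpace ℝ (Fin 3))), ∀ R ε : ℝ, 0 < ε → ∀ ρ : ℝ, ρ < (P T).toReal → ∀ᶠ j : ℕ in Filter.atTop, ρ * (φ j : ℝ) ≤ (Nat.card {i : Fin (φ j) // ∃ ν ∈ T, ((∀ p : EuclideanSpace ℝ (Fin 3), ν {p} ≠ 0 → ‖p‖ ≤ R → ∃ q ∈ (Set.range (fun k : Fin (φ j) => x (φ j) k - x (φ j) i)), dist q p ≤ ε) ∧ (∀ q ∈ (Set.range (fun k : Fin (φ j) => x (φ j) k - x (φ j) i)), ‖q‖ ≤ R → ∃ p : EuclideanSpace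 ℝ (Fin 3), ν {p} ≠ 0 ∧ dist q p ≤ ε))} : ℝ)) → NoFoam → CrysEnergyLimit → (∀ x : (N : ℕ) → (Fin N → EuclideanSpace ℝ (Fin 3)), (∀ N, Literature.MathematicalPhysics.StatisticalMechanics.IsGroundState Literature.MathematicalPhysics.StatisticalMechanics.lennardJones (x N)) → ∃ Q : Literature.MathematicalPhysics.StatisticalMechanics.PeriodicConfiguration 3, ∀ R ε : ℝ, 0 < R → 0 < ε → ∃ ρ : ℝ, 0 < ρ ∧ ∃ᶠ N : ℕ in Filter.atTop, ρ * (N : ℝ) ≤ (Nat.card {i : Fin N // ∃ A : EuclideanSpace ℝ (Fin 3) →ₗᵢ[ℝ] EuclideanSpace ℝ (Fin 3), ∃ q ∈ Q.points, (∀ s ∈ Q.points, dist s q ≤ R → ∃ j : Fin N, dist (x N j) (x N i + A (s - q)) ≤ ε) ∧ (∀ j : Fin N, dist (x N j) (x N i) ≤ R → ∃ s ∈ Q.points, dist (x N j) (x N i + A (s - q)) ≤ ε)} : ℝ))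

/-- item stmt-AtomisticToContinuum-2911 · support · rank 9 · open · by planner
sources: BlancLewin2015, AldousSteele2004
[crux] (finite-N hinge; deterministic shadow of "the Benjamini–Schramm limit of the ground states
charges Q") for every sequence of LJ ground states x^N in ℝ³ there is ONE periodic configuration Q
such that for all R, ε > 0 there is ρ > 0 with, for infinitely many N, at least ρN particles i whose
R-neighbourhood x^N ∩ B_R(x_i) is ε-matched both ways with x_i + A(Q.points − q) for some linear
isometry A and some base point q ∈ Q.points (base point in Q.points, not a fixed origin: no
vertex-transitivity is forced, cf. refuter note on 0751). Weaker than BulkDefectVanish 0751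
(fraction → 1, fixed HCP): positive density, frequently in N, any periodic Q. [deps:
StationaryMinimisersChargePeriodic, NoFoam] [difficulty: XL] -/
@[route_item "route-AtomisticToContinuum-SurfaceTensionNoFoam"]
def GroundStatesChargePeriodic : Prop :=
  ∀ x : (N : ℕ) → (Fin N → EuclideanSpace ℝ (Fin 3)), (∀ N, Literature.MathematicalPhysics.StatisticalMechanics.IsGroundState Literature.MathematicalPhysics.StatisticalMechanics.lennardJones (x N)) → ∃ Q : Literature.MathematicalPhysics.StatisticalMechanics.PeriodicConfiguration 3, ∀ R ε : ℝ, 0 < R → 0 < ε → ∃ ρ : ℝ, 0 < ρ ∧ ∃ᶠ N : ℕ in Filter.atTop, ρ * (N : ℝ) ≤ (Nat.card {i : Fin N // ∃ A : EuclideanSpace ℝ (Fin 3) →ₗᵢ[ℝ] EuclideanSpace ℝ (Fin 3), ∃ q ∈ Q.points, (∀ s ∈ Q.points, dist s q ≤ R → ∃ j : Fin N, dist (x N j) (x N i + A (s - q)) ≤ ε) ∧ (∀ j : Fin N, dist (x N j) (x N i) ≤ R → ∃ s ∈ Q.points, dist (x N j) (x N i + A (s - q)) ≤ ε)} : ℝ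)

/-- item stmt-AtomisticToContinuum-2913 · support · rank 9 · closed · proved by Summit.AtomisticToContinuum.Crystallization.Theorems.chargedPeriodicIsOptimal_proof (prover) · by planner
sources: BlancLewin2015, AldousSteele2004
[support] (card item A3, SURGERY-ATTAINMENT; conjunct (i) from a support statement) if a periodic
configuration Q is charged by some sequence of LJ ground states with positive density at every scale
(the conclusion of GroundStatesChargePeriodic for this Q), then e(Q) is the least value of the
energy per particle over all periodic configurations. Proof sketch: if e(Q') < e(Q), pick R ≫
1/(e(Q) − e(Q')) and ε small; along the infinitely many N with ≥ ρN good particles select ≥ ρN/(C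
R³) disjoint good R-balls (hard-core packing bound, in tree), excise each patch (n ≈ |Q ∩ B_R|
particles, self-energy ≥ n e(Q) − Cεn − CR², cross terms ≥ −CR² by the r⁻⁶ tail and
LennardJonesMinimalDistance) and insert a Q'-patch of radius R − 1 with n' ≤ n particles (margin 1 ⇒
all new cross terms ≤ 0); compare E(N') ≤ E_mod with E(M)/M → e_∞ (BlancLewin2015_8_holds, proved)
and e_∞ ≤ e(Q') (trial states, 0629): 0 ≤ k[(n' − n)(e(Q') − e_∞) − n(e(Q) − e(Q')) + CR² + Cεn] +
o(N) with k ≥ cρN/R³ is absurd for R large. No Wulff shapes, no rates. [difficulty: M] -/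
@[route_item "route-AtomisticToContinuum-SurfaceTensionNoFoam"]
def ChargedPeriodicIsOptimal : Prop :=
  ∀ Q : Literature.MathematicalPhysics.StatisticalMechanics.PeriodicConfiguration 3, (∃ x : (N : ℕ) → (Fin N → EuclideanSpace ℝ (Fin 3)), (∀ N, Literature.MathematicalPhysics.StatisticalMechanics.IsGroundState Literature.MathematicalPhysics.StatisticalMechanics.lennardJones (x N)) ∧ ∀ R ε : ℝ, 0 < R → 0 < ε → ∃ ρ : ℝ, 0 < ρ ∧ ∃ᶠ N : ℕ in Filter.atTop, ρ * (N : ℝ) ≤ (Nat.card {i : Fin N // ∃ A : EuclideanSpace ℝ (Fin 3) →ₗᵢ[ℝ] EuclideanSpace ℝ (Fin 3), ∃ q ∈ Q.points, (∀ s ∈ Q.points, dist s q ≤ R → ∃ j : Fin N, dist (x N j) (x N i + A (s - q)) ≤ ε) ∧ (∀ j : Fin N, dist (x N j) (x N i) ≤ R → ∃ s ∈ Q.points, dist (x N j) (x N i + A (s - q)) ≤ ε)} : ℝ)) → IsLeast (Set.range fun Q' : Literature.MathematicalPhysics.StatisticalMechanics.PeriodicConfiguration 3 => Q'.energyPerParticle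 Literature.MathematicalPhysics.StatisticalMechanics.lennardJones) (Q.energyPerParticle Literature.MathematicalPhysics.StatisticalMechanics.lennardJones)

/-- `ChargedPeriodicIsOptimal` holds: proved by `Summit.AtomisticToContinuum.Crystallization.Theorems.chargedPeriodicIsOptimal_proof`. -/
theorem ChargedPeriodicIsOptimal_holds : ChargedPeriodicIsOptimal := _root_.Summit.AtomisticToContinuum.Crystallization.Theorems.chargedPeriodicIsOptimal_proof

/-- item stmt-AtomisticToContinuum-2916 · support · rank 9 · closed · proved by Summit.AtomisticToContinuum.Crystallization.Theorems.chargedPatternCrystallizes_proof (prover) · by planner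
sources: BlancLewin2015
[support] (soft) GroundStatesChargePeriodic → LennardJonesMinimalDistance → IsCrystallizing
lennardJones 3: choose scales (k, 1/k), indices N_k ↑ with a good particle i_k, isometries A_k → A
along a subsequence (compactness of O(3)), τ_k := −x_(i_k) + alignment; the two-way matching with
minimal distance is eventually exact near every compact set, so
PeriodicConfiguration.tendsto_sum_of_eventually_near' (in tree) gives local convergence to the
periodic configuration A(Q − q) (isometryImage/translate in CrystallizationSymmetries), multiplicity
1. [difficulty: M] -/
@[route_item "route-AtomisticToContinuum-SurfaceTensionNoFoam"]
def ChargedPatternCrystallizes : Prop :=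
  GroundStatesChargePeriodic → Literature.MathematicalPhysics.StatisticalMechanics.LennardJonesMinimalDistance → Literature.MathematicalPhysics.StatisticalMechanics.IsCrystallizing Literature.MathematicalPhysics.StatisticalMechanics.lennardJones 3

/-- `ChargedPatternCrystallizes` holds: proved by `Summit.AtomisticToContinuum.Crystallization.Theorems.chargedPatternCrystallizes_proof`. -/
theorem ChargedPatternCrystallizes_holds : ChargedPatternCrystallizes := _root_.Summit.AtomisticToContinuum.Crystallization.Theorems.chargedPatternCrystallizes_proof

/-- item stmt-AtomisticToContinuum-9230 · support · rank 9 · closed · proved by Summit.AtomisticToContinuum.Crystallization.Theorems.benjaminiSchrammLimit_proof_periodicSupport @ 44e2423ddfbc (prover) · by planner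
sources: AldousLyons2007, AldousSteele2004, LastPenrose2017, BlancLewin2015, HevelingLast2005
[support] CONSTRUCTION (card U3; existence kept separate from the interface): for every sequence of
LJ ground states x^N there are a subsequence φ, a hard core δ > 0 and a probability law P on rooted
δ-separated configurations which is point-stationary, has E_P[h] = lim_j E(φ j)/φ j (stated as
Tendsto), and is a LOCAL LIMIT in the density-transfer (portmanteau) form the assembly uses: for
every set T of configurations, every R, ε > 0 and every ρ < P(T), for all large j at least ρ·φ(j)
particles i of x^(φ j) have their recentred configuration (R, ε)-matched (both ways, inside the ball
of radius R) to some ν ∈ T. Proof: P_N := (1/N) Σ_i δ_(count|(x^N − x_i)); mass transport is an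
exact finite identity; E_(P_N)[h] = E(N)/N; compactness of rooted (1/3)-separated configurations in
the local topology (LennardJonesMinimalDistance_holds); h is a uniform limit of bounded local
continuous functionals (tail ≤ C R^-3); unimodularity passes to the limit; transfer by Skorokhod /
portmanteau with open fattenings. [difficulty: XL] -/
@[route_item "route-AtomisticToContinuum-SurfaceTensionNoFoam"]
def BenjaminiSchrammLimit : Prop :=
  ∀ x : (N : ℕ) → (Fin N → EuclideanSpace ℝ (Fin 3)), (∀ N, Literature.MathematicalPhysics.StatisticalMechanics.IsGroundState Literature.MathematicalPhysics.StatisticalMechanics.lennardJones (x N)) → ∃ φ : ℕ → ℕ, StrictMono φ ∧ ∃ δ : ℝ, 0 < δ ∧ ∃ P : MeasureTheory.Measure (MeasureTheory.Measure (EuclideanSpace ℝ (Fin 3))), MeasureTheory.IsProbabilityMeasure P ∧ (∀ᵐ μ ∂P, (∃ S : Set (EuclideanSpace ℝ (Fin 3)), (0 : EuclideanSpace ℝ (Fin 3)) ∈ S ∧ (∀ x ∈ S, ∀ y ∈ S, x ≠ y → δ ≤ dist x y) ∧ μ = (MeasureTheory.Measure.count : MeasureTheory.Measure (EuclideanSpace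 ℝ (Fin 3))).restrict S)) ∧ (∀ g : MeasureTheory.Measure (EuclideanSpace ℝ (Fin 3)) → EuclideanSpace ℝ (Fin 3) → ENNReal, Measurable (Function.uncurry g) → ∫⁻ μ, ∫⁻ y, g μ y ∂μ ∂P = ∫⁻ μ, ∫⁻ y, g (MeasureTheory.Measure.map (fun z => z - y) μ) (-y) ∂μ ∂P) ∧ Filter.Tendsto (fun j : ℕ => Literature.MathematicalPhysics.StatisticalMechanics.groundStateEnergy Literature.MathematicalPhysics.StatisticalMechanics.lennardJones 3 (φ j) / (φ j : ℝ)) Filter.atTop (nhds (∫ μ, (∫ y, Literature.MathematicalPhysics.StatisticalMechanics.lennardJones ‖y‖ ∂μ) / 2 ∂P)) ∧ ∀ T : Set (MeasureTheory.Measure (EuclideanSpace ℝ (Fin 3))), ∀ R ε : ℝ, 0 < ε → ∀ ρ : ℝ, ρ < (P T).toReal → ∀ᶠ j : ℕ in Filter.atTop, ρ * (φ j : ℝ) ≤ (Nat.card {i : Fin (φ j) // ∃ ν ∈ T, ((∀ p : EuclideanSpace ℝ (Fin 3), ν {p} ≠ 0 → ‖p‖ ≤ R → ∃ q ∈ (Set.range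 (fun k : Fin (φ j) => x (φ j) k - x (φ j) i)), dist q p ≤ ε) ∧ (∀ q ∈ (Set.range (fun k : Fin (φ j) => x (φ j) k - x (φ j) i)), ‖q‖ ≤ R → ∃ p : EuclideanSpace ℝ (Fin 3), ν {p} ≠ 0 ∧ dist q p ≤ ε))} : ℝ)

/-- `BenjaminiSchrammLimit` holds: proved by `Summit.AtomisticToContinuum.Crystallization.Theorems.benjaminiSchrammLimit_proof_periodicSupport` @ 44e2423ddfbc. -/
theorem BenjaminiSchrammLimit_holds : BenjaminiSchrammLimit := _root_.Summit.AtomisticToContinuum.Crystallization.Theorems.benjaminiSchrammLimit_proof_periodicSupport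

/-- item stmt-AtomisticToContinuum-13456 · assembly · rank 1 · open · by planner
sources: BlancLewin2015, AldousLyons2007
[assembly] ExposedSitesCost → DeloneMinimisersChargePeriodic → ExposedCostGivesNoFoam →
RootedLimitGlue → BenjaminiSchrammLimit → CrysEnergyLimit → ChargedPeriodicIsOptimal →
ChargedPatternCrystallizes → Crystallization (LJ, d = 3; the sub-problem decl
`_root_.Crystallization`). -/
@[route_item "route-AtomisticToContinuum-SurfaceTensionNoFoam"]
def Assembly : Prop :=
  ExposedSitesCost → DeloneMinimisersChargePeriodic → ExposedCostGivesNoFoam → RootedLimitGlue → BenjaminiSchrammLimit → CrysEnergyLimit → ChargedPeriodicIsOptimal → ChargedPatternCrystallizes → _root_.Crystallization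

/-! D-0027 §2.1 — DECIDING THEOREM (planner-authored via `route open/edit --closes-file`; by planner-plancard-AtomisticToContinuum-Crystal-2c2c210b-g2-0 2026-08-15T19:01:46Z):
its hypotheses are this route's items and its conclusion the sub-problem Statement (glue_lint), and it elaborates with this file. -/

@[closes "route-AtomisticToContinuum-SurfaceTensionNoFoam"] theorem closes : ExposedSitesCost → DeloneMinimisersChargePeriodic → VoidWallDeficit → SurfaceTensionPositive → ReflectionDoubling → NoFoam → CrysEnergyLimit → ExposedCostGivesNoFoam → BenjaminiSchrammLimit → GroundStatesChargePeriodic → RootedLimitGlue → ChargedPeriodicIsOptimal → ChargedPatternCrystallizes → Assembly → _root_.Crystallization := by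
  intro hExp hDel _hVW _hST _hRD _hNF hLim hENF hBS _hGCP hGlue hOpt hCryst _hA
  -- cohesion (NoFoam) DERIVED from the surface crux ExposedSitesCost and the energy limit
  have hNF : NoFoam := hENF hExp hLim
  -- the shared hinge DERIVED from the bulk crux through the rooted local limit, fed by NoFoam
  have hGCP : GroundStatesChargePeriodic := hGlue hDel hBS hNF hLim
  show Literature.MathematicalPhysics.StatisticalMechanics.HasPeriodicGroundStateEnergy
      Literature.MathematicalPhysics.StatisticalMechanics.lennardJones 3 ∧
    Literature.MathematicalPhysics.StatisticalMechanics.IsCrystallizing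
      Literature.MathematicalPhysics.StatisticalMechanics.lennardJones 3
  refine ⟨?_, hCryst hGCP
    Literature.MathematicalPhysics.StatisticalMechanics.LennardJonesMinimalDistance_holds⟩
  -- energetic half: a ground-state sequence exists, its charged `Q` is optimal, and `⨅ = e(Q)`
  choose x hx using
    (show ∀ N : ℕ, ∃ y : Fin N → EuclideanSpace ℝ (Fin 3),
        Literature.MathematicalPhysics.StatisticalMechanics.IsGroundState
          Literature.MathematicalPhysics.StatisticalMechanics.lennardJones y from
      Literature.MathematicalPhysics.StatisticalMechanics.LennardJonesGroundStatesExist_holds)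
  obtain ⟨Q, hQ⟩ := hGCP x hx
  have hleast := hOpt Q ⟨x, hx, hQ⟩
  refine ⟨Q, hleast, ?_⟩
  rw [← hleast.csInf_eq]
  exact hLim

end Summit.AtomisticToContinuum.Crystallization.Theses.SurfaceTensionNoFoam
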